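import Literature.Probability.LatticeModels.IsingConsistency
import Literature.Probability.LatticeModels.IsingBoundaryMonotonicity
import Literature.Probability.LatticeModels.IsingMonotonicity
import Literature.Probability.LatticeModels.LatticeAnimalsGraph
import HarnessLib

/-!
# Screening of a boundary condition by an explored `-` cluster (spatial Markov property + FKG)

Topic `Probability/LatticeModels` (any locally finite graph, any fixed boundary condition,
`β ≥ 0`, any `h`). The finite-volume mechanism by which "the image spins in the annulus are
capable of determining the internal-spin phase … no matter what happens outside"
(van Enter–Fernández–Sokal 1993, §4.3.1 Step 2; the finite-volume content of their Steps
2.1–2.2), organised as the classical "exploration from the outside" argument (the spatial Markov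
property of Friedli–Velenik 2017, Exercise 3.11 / eq. (3.26) and Lemma 6.7, combined with the FKG
inequality, Theorem 3.21, exactly as in the proof that the `+` boundary condition dominates,
Lemma 3.23 / Exercise 3.12):

Let `W` be a finite volume, `U ⊆ W` an "exploration region", `L ⊆ U` a "cut", `D` a finite set of
frozen sites ("seeds") off `W`, and `η⁻ ≤ η⁺`… (two boundary conditions agreeing off `D`) such that
every `W`-neighbour of `D` lies in `U` and every `U`-neighbour of `W ∖ U` lies in `L`. For a
configuration `σ` let `𝒞(σ)` be the set of sites of `U` carrying a `-` spin and joined to `D` by a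
nearest-neighbour chain of `-` spins of `U` (the `-` cluster of the seeds explored inside `U`), and
call `σ` GOOD when `𝒞(σ)` misses `L`. Then for every nondecreasing nonnegative observable `f`
depending only on spins in `W ∖ U`:

`⟨f⟩^{η⁻}_W ≥ μ^{η⁻}_W(GOOD) · ⟨f⟩^{η⁺}_W` (`isingExpect_mul_le_of_screening`),

and `μ^{η⁻}_W(not GOOD) ≤ ∑_T μ^{η⁻}_W(σ ≡ -1 on T, σ ≡ +1 on ∂_U T)` over the connected
`T ⊆ U` meeting `L` and adjacent to `D` (`isingMeasure_bad_le_sum`), ready for Peierls' flip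
estimate (`IsingPeierlsFlip`).

## Contents (all proved)

* `cylInd K ζ` — the indicator of the cylinder `{σ ≡ ζ on K}`; a boundary condition `η` updated
  by `ζ` on `K` (`η[ζ on K]`) is the tree's `reglue K η ζ` (`IsingBoundaryMonotonicity`).
* `isingExpect_mul_cylInd` — **conditioning on a cylinder inside the volume**:
  `⟨g · 𝟙{σ ≡ ζ on K}⟩^η_W = ⟨𝟙{σ ≡ ζ on K}⟩^η_W · ⟨g⟩^{η[ζ on K]}_{W∖K}` (`K ⊆ W`), from the
  two-step decomposition `sum_isingWeight_fixed_eq_sum_sum` of `IsingConsistency`.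
* `isingExpect_le_isingExpect_sdiff_reglue_one` — **FKG: freezing sites to `+` raises
  nondecreasing observables**: `⟨f⟩^η_W ≤ ⟨f⟩^{η[+ on K]}_{W∖K}`.
* `exploredCluster`, `clusterBoundary`, `IsSeedConnected`, `exploredCluster_eq_iff` — the explored
  cluster and its characterisation `𝒞(σ) = C₀ ↔ (σ ≡ -1 on C₀, σ ≡ +1 on ∂⁺C₀, C₀ seed-connected)`.
* `isingExpect_mul_le_of_screening`, `isingMeasure_bad_le_sum` (above).

## References

* S. Friedli, Y. Velenik, *Statistical Mechanics of Lattice Systems* (CUP 2017), §3.6.2–3.6.3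
  (Thm. 3.21, Lemma 3.23, Exercises 3.11–3.12, eq. (3.26)), Lemma 6.7 [FriedliVelenik2017].
* A. C. D. van Enter, R. Fernández, A. D. Sokal, J. Stat. Phys. 72 (1993) 879, §4.3.1 Steps
  2.1–2.2 [VanenterFernandezSokal1993].
-/

noncomputable section

open MeasureTheory Finset

namespace Literature.Probability.LatticeModels

variable {V : Type*} (G : SimpleGraph V) [DecidableEq V] [G.LocallyFinite]

/-! ### Updating a boundary condition on a finite set; cylinder indicators -/

omit G in
/-- The indicator of the cylinder `{σ ≡ ζ on K}`. [cite: FriedliVelenik2017, §3.6.3, eq. (3.26)] -/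
def cylInd (K : Finset V) (ζ σ : SpinConfig V) : ℝ :=
  if ∀ x ∈ K, σ x = ζ x then 1 else 0

omit G [DecidableEq V] in
/-- `cylInd` takes the values `0` and `1`. [folklore] -/
theorem cylInd_nonneg (K : Finset V) (ζ σ : SpinConfig V) : 0 ≤ cylInd K ζ σ := by
  unfold cylInd; split_ifs <;> norm_num

omit G [DecidableEq V] in
/-- `cylInd ≤ 1`. [folklore] -/
theorem cylInd_le_one (K : Finset V) (ζ σ : SpinConfig V) : cylInd K ζ σ ≤ 1 := by
  unfold cylInd; split_ifs <;> norm_num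

omit G [DecidableEq V] in
/-- The cylinder `{σ ≡ ζ on K}` is measurable. [cite: FriedliVelenik2017, §6.2] -/
theorem measurableSet_cylinderOn (K : Finset V) (ζ : SpinConfig V) :
    MeasurableSet {σ : SpinConfig V | ∀ x ∈ K, σ x = ζ x} := by
  have h1 : ∀ x : V, MeasurableSet ((fun σ : SpinConfig V => σ x) ⁻¹' ({ζ x} : Set ℤˣ)) :=
    fun x => measurable_pi_apply x (measurableSet_singleton _)
  have heq : {σ : SpinConfig V | ∀ x ∈ K, σ x = ζ x} =
      ⋂ x ∈ K, (fun σ : SpinConfig V => σ x) ⁻¹' ({ζ x} : Set ℤˣ) := by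
    ext σ
    simp only [Set.mem_setOf_eq, Set.mem_iInter, Set.mem_preimage, Set.mem_singleton_iff]
  rw [heq]
  exact Finset.measurableSet_biInter _ fun x _ => h1 x

omit G [DecidableEq V] in
/-- `cylInd K ζ` is measurable. [cite: FriedliVelenik2017, §6.2] -/
@[fun_prop]
theorem measurable_cylInd (K : Finset V) (ζ : SpinConfig V) : Measurable (cylInd K ζ) := by
  classical
  have : cylInd K ζ = Set.indicator {σ : SpinConfig V | ∀ x ∈ K, σ x = ζ x} 1 := by
    funext σ
    by_cases h : ∀ x ∈ K, σ x = ζ x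
    · rw [Set.indicator_of_mem (show σ ∈ {σ : SpinConfig V | ∀ x ∈ K, σ x = ζ x} from h)]
      simp only [cylInd, if_pos h, Pi.one_apply]
    · rw [Set.indicator_of_notMem (show σ ∉ {σ : SpinConfig V | ∀ x ∈ K, σ x = ζ x} from h)]
      simp only [cylInd, if_neg h]
  rw [this]
  exact measurable_const.indicator (measurableSet_cylinderOn K ζ)

omit G [DecidableEq V] in
/-- The cylinder `{σ ≡ +1 on K}` is the tree's `plusIndicator`. [folklore] -/
theorem cylInd_one (K : Finset V) : cylInd K (1 : SpinConfig V) = plusIndicator K := by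
  funext σ
  rw [plusIndicator_eq]
  rfl

/-! ### Conditioning on a cylinder inside the volume (spatial Markov property) -/

/-- **Conditioning the finite-volume measure on a cylinder inside the volume** (the spatial
Markov property, Friedli–Velenik 2017, Exercise 3.11, eq. (3.26), via the two-step decomposition
of Lemma 6.7): for `K ⊆ W` and any measurable `g`,
`⟨g · 𝟙{σ ≡ ζ on K}⟩^η_{W;β,h} = ⟨𝟙{σ ≡ ζ on K}⟩^η_{W;β,h} · ⟨g⟩^{η[ζ on K]}_{W∖K;β,h}`, together
with the strict positivity of `⟨𝟙{σ ≡ ζ on K}⟩^η_W`.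
[cite: FriedliVelenik2017, Exercise 3.11, eq. (3.26)] -/
theorem isingExpect_mul_cylInd_and_pos {W K : Finset V} (hK : K ⊆ W) (β h : ℝ)
    (η ζ : SpinConfig V) {g : SpinConfig V → ℝ} (hg : Measurable g) :
    isingExpect G W β h (.fixed η) (fun σ => g σ * cylInd K ζ σ) =
        isingExpect G W β h (.fixed η) (cylInd K ζ) *
          isingExpect G (W \ K) β h (.fixed (reglue K η ζ)) g ∧
      0 < isingExpect G W β h (.fixed η) (cylInd K ζ) := by
  classical
  have hsub : W \ K ⊆ W := Finset.sdiff_subset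
  have hKK : W \ (W \ K) = K := Finset.sdiff_sdiff_eq_self hK
  have hmemK : ∀ x, x ∈ W \ (W \ K) ↔ x ∈ K := fun x => by rw [hKK]
  obtain ⟨R, hRpos, hR⟩ := exists_sum_isingWeight_fixed_eq G hsub η β h
  -- the `K`-part of `ζ`, as a finite configuration on `W ∖ (W ∖ K) = K`
  set ζK : ↥(W \ (W \ K)) → ℤˣ := fun x => ζ x with hζK
  have hbc : glue (W \ (W \ K)) ζK (.fixed η) = reglue K η ζ := by
    funext x
    by_cases hx : x ∈ K
    · have hx' : x ∈ W \ (W \ K) := (hmemK x).2 hx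
      rw [glue_apply_of_mem _ _ _ hx', reglue_apply_of_mem _ _ _ hx]
    · have hx' : x ∉ W \ (W \ K) := fun h' => hx ((hmemK x).1 h')
      rw [glue_apply_of_notMem _ _ _ hx', reglue_apply_of_notMem _ _ _ hx]
      rfl
  -- the cylinder indicator on a configuration glued in two steps tests the `K`-part
  have hcyl : ∀ (τ₂ : ↥(W \ (W \ K)) → ℤˣ) (τ₁ : ↥(W \ K) → ℤˣ),
      cylInd K ζ (glue (W \ K) τ₁ (.fixed (glue (W \ (W \ K)) τ₂ (.fixed η)))) =
        if τ₂ = ζK then 1 else 0 := by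
    intro τ₂ τ₁
    have hval : ∀ x (hx : x ∈ K),
        glue (W \ K) τ₁ (.fixed (glue (W \ (W \ K)) τ₂ (.fixed η))) x = τ₂ ⟨x, (hmemK x).2 hx⟩ := by
      intro x hx
      have hx1 : x ∉ W \ K := fun h' => (Finset.mem_sdiff.1 h').2 hx
      rw [glue_apply_of_notMem _ _ _ hx1, BoundaryCondition.outside_fixed,
        glue_apply_of_mem _ _ _ ((hmemK x).2 hx)]
    unfold cylInd
    by_cases hτ : τ₂ = ζK
    · rw [if_pos hτ, if_pos]
      intro x hx
      rw [hval x hx, hτ]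
    · rw [if_neg hτ, if_neg]
      intro hall
      apply hτ
      funext x
      have hxK : (x : V) ∈ K := (hmemK x).1 x.2
      have := hall x hxK
      rw [hval x hxK] at this
      exact this
  -- the two Boltzmann sums
  have hS : ∀ F : SpinConfig V → ℝ,
      ∑ τ : W → ℤˣ, isingWeight G W β h (.fixed η) τ *
          (F (glue W τ (.fixed η)) * cylInd K ζ (glue W τ (.fixed η))) =
        R ζK * ∑ τ₁ : ↥(W \ K) → ℤˣ, isingWeight G (W \ K) β h (.fixed (reglue K η ζ)) τ₁ *
          F (glue (W \ K) τ₁ (.fixed (reglue K η ζ))) := by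
    intro F
    rw [hR (fun σ => F σ * cylInd K ζ σ)]
    rw [Finset.sum_eq_single ζK]
    · rw [hbc]
      congr 1
      refine Finset.sum_congr rfl fun τ₁ _ => ?_
      rw [← hbc, hcyl, if_pos rfl, mul_one]
    · intro τ₂ _ hτ₂
      rw [Finset.sum_eq_zero fun τ₁ _ => by rw [hcyl, if_neg hτ₂, mul_zero, mul_zero], mul_zero]
    · intro h'; exact absurd (Finset.mem_univ _) h'
  have hZ := isingPartitionFunction_pos G W β h (.fixed η)
  have hZ' := isingPartitionFunction_pos G (W \ K) β h (.fixed (reglue K η ζ))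
  have hgc : Measurable fun σ => g σ * cylInd K ζ σ := hg.mul (measurable_cylInd K ζ)
  -- `⟨cyl⟩ = R Z' / Z`
  have hEcyl : isingExpect G W β h (.fixed η) (cylInd K ζ) =
      R ζK * isingPartitionFunction G (W \ K) β h (.fixed (reglue K η ζ)) /
        isingPartitionFunction G W β h (.fixed η) := by
    rw [isingExpect_eq_sum_div G W h _ β (measurable_cylInd K ζ)]
    have := hS fun _ => 1
    simp only [one_mul, mul_one] at this
    rw [this]
    rfl
  have hpos : 0 < isingExpect G W β h (.fixed η) (cylInd K ζ) := by
    rw [hEcyl]; exact div_pos (mul_pos (hRpos _) hZ') hZ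
  refine ⟨?_, hpos⟩
  rw [isingExpect_eq_sum_div G W h _ β hgc, hS g, hEcyl,
    isingExpect_eq_sum_div G (W \ K) h _ β hg]
  field_simp

/-- **Conditioning on a cylinder inside the volume** (the identity alone).
[cite: FriedliVelenik2017, Exercise 3.11, eq. (3.26)] -/
theorem isingExpect_mul_cylInd {W K : Finset V} (hK : K ⊆ W) (β h : ℝ) (η ζ : SpinConfig V)
    {g : SpinConfig V → ℝ} (hg : Measurable g) :
    isingExpect G W β h (.fixed η) (fun σ => g σ * cylInd K ζ σ) =
      isingExpect G W β h (.fixed η) (cylInd K ζ) *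
        isingExpect G (W \ K) β h (.fixed (reglue K η ζ)) g :=
  (isingExpect_mul_cylInd_and_pos G hK β h η ζ hg).1

/-- Every cylinder inside the volume has strictly positive probability (finite energy).
[cite: FriedliVelenik2017, §3.1] -/
theorem isingExpect_cylInd_pos {W K : Finset V} (hK : K ⊆ W) (β h : ℝ) (η ζ : SpinConfig V) :
    0 < isingExpect G W β h (.fixed η) (cylInd K ζ) :=
  (isingExpect_mul_cylInd_and_pos G hK β h η ζ (g := fun _ => (1 : ℝ)) measurable_const).2

/-- **Freezing sites to `+1` raises nondecreasing observables** (FKG, Friedli–Velenik 2017,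
Theorem 3.21, in the form of Lemma 3.23 / Exercise 3.12 for an arbitrary fixed boundary
condition): for `K ⊆ W`, `β ≥ 0` and `f` nondecreasing,
`⟨f⟩^η_{W;β,h} ≤ ⟨f⟩^{η[+1 on K]}_{W∖K;β,h}` — the right side is `⟨f⟩^η_W` conditioned on the
increasing event `{σ ≡ +1 on K}`. [cite: FriedliVelenik2017, Lemma 3.23 and Exercise 3.12] -/
theorem isingExpect_le_isingExpect_sdiff_reglue_one {W K : Finset V} (hK : K ⊆ W) {β : ℝ}
    (hβ : 0 ≤ β) (h : ℝ) (η : SpinConfig V) {f : SpinConfig V → ℝ} (hf : Monotone f)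
    (hfm : Measurable f) :
    isingExpect G W β h (.fixed η) f ≤
      isingExpect G (W \ K) β h (.fixed (reglue K η 1)) f := by
  obtain ⟨hid, hpos⟩ := isingExpect_mul_cylInd_and_pos G hK β h η 1 hfm
  have hmono : Monotone (cylInd K (1 : SpinConfig V)) := by
    rw [cylInd_one]; exact plusIndicator_mono K
  have hfkg := ising_fkg_holds G hβ W h (.fixed η) f (cylInd K 1) hf hmono hfm (measurable_cylInd K 1)
  have hprod : isingExpect G W β h (.fixed η) (f * cylInd K 1) =
      isingExpect G W β h (.fixed η) (fun σ => f σ * cylInd K 1 σ) := rfl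
  rw [hprod, hid] at hfkg
  rw [mul_comm] at hfkg
  exact le_of_mul_le_mul_left hfkg hpos


/-! ### The explored `-` cluster of a set of seeds -/

section Cluster

variable (U D : Finset V)

/-- One exploration step: from a site `a` of `U` carrying a `-` spin to any neighbour `b`.
[cite: FriedliVelenik2017, Lemma 3.23 (proof)] -/
def minusStep (σ : SpinConfig V) (a b : V) : Prop :=
  a ∈ U ∧ σ a = -1 ∧ G.Adj a b

/-- `x` is joined to a seed by a chain of exploration steps: `x = x₀ ∼ x₁ ∼ ⋯ ∼ x_k ∈ D` with
`x₀, …, x_{k-1}` sites of `U` carrying `-` spins. [cite: FriedliVelenik2017, Lemma 3.23 (proof)] -/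
def ReachesSeed (σ : SpinConfig V) (x : V) : Prop :=
  ∃ z ∈ D, Relation.ReflTransGen (minusStep G U σ) x z

/-- **The explored cluster** `𝒞(σ)`: the sites of `U` joined to the seeds `D` through `-` spins
of `U` (the `-` cluster of `D` grown inside `U`; "exploration from the outside").
[cite: FriedliVelenik2017, Lemma 3.23 (proof)] -/
def exploredCluster (σ : SpinConfig V) : Finset V :=
  open Classical in U.filter fun x => ReachesSeed G U D σ x

/-- The layer sealing a candidate cluster `C₀` inside `U`: the sites of `U ∖ C₀` adjacent to
`C₀ ∪ D`. [cite: FriedliVelenik2017, Lemma 3.23 (proof)] -/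
def clusterBoundary (C₀ : Finset V) : Finset V :=
  open Classical in (U \ C₀).filter fun x => ∃ y ∈ C₀ ∪ D, G.Adj x y

/-- `C₀` is seed-connected: each of its sites is joined to `D` by a chain inside `C₀`.
[cite: FriedliVelenik2017, Lemma 3.23 (proof)] -/
def IsSeedConnected (C₀ : Finset V) : Prop :=
  ∀ x ∈ C₀, ∃ z ∈ D, Relation.ReflTransGen (fun a b => a ∈ C₀ ∧ G.Adj a b) x z

variable {U D}

omit [DecidableEq V] [G.LocallyFinite] in
/-- Membership in the explored cluster. [cite: FriedliVelenik2017, Lemma 3.23 (proof)] -/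
theorem mem_exploredCluster {σ : SpinConfig V} {x : V} :
    x ∈ exploredCluster G U D σ ↔ x ∈ U ∧ ReachesSeed G U D σ x := by
  classical
  simp [exploredCluster]

omit [DecidableEq V] [G.LocallyFinite] in
/-- The explored cluster lies in `U`. [cite: FriedliVelenik2017, Lemma 3.23 (proof)] -/
theorem exploredCluster_subset (σ : SpinConfig V) : exploredCluster G U D σ ⊆ U :=
  fun _ hx => ((mem_exploredCluster G).1 hx).1

omit [G.LocallyFinite] in
/-- Membership in the sealing layer. [cite: FriedliVelenik2017, Lemma 3.23 (proof)] -/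
theorem mem_clusterBoundary {C₀ : Finset V} {x : V} :
    x ∈ clusterBoundary G U D C₀ ↔ x ∈ U ∧ x ∉ C₀ ∧ ∃ y ∈ C₀ ∪ D, G.Adj x y := by
  classical
  simp only [clusterBoundary, Finset.mem_filter, Finset.mem_sdiff, and_assoc]

omit [G.LocallyFinite] in
/-- A site of `U` off `C₀` adjacent to a seed belongs to the sealing layer.
[cite: FriedliVelenik2017, Lemma 3.23 (proof)] -/
theorem mem_clusterBoundary_of_adj_seed {C₀ : Finset V} {x z : V} (hx : x ∈ U) (hxC : x ∉ C₀)
    (hz : z ∈ D) (hadj : G.Adj x z) : x ∈ clusterBoundary G U D C₀ :=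
  (mem_clusterBoundary G).2 ⟨hx, hxC, z, Finset.mem_union_right _ hz, hadj⟩

omit [G.LocallyFinite] in
/-- A site of `U` off `C₀` adjacent to `C₀` belongs to the sealing layer.
[cite: FriedliVelenik2017, Lemma 3.23 (proof)] -/
theorem mem_clusterBoundary_of_adj_mem {C₀ : Finset V} {x y : V} (hx : x ∈ U) (hxC : x ∉ C₀)
    (hy : y ∈ C₀) (hadj : G.Adj x y) : x ∈ clusterBoundary G U D C₀ :=
  (mem_clusterBoundary G).2 ⟨hx, hxC, y, Finset.mem_union_left _ hy, hadj⟩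

omit [DecidableEq V] [G.LocallyFinite] in
/-- If `b` is joined to a seed and `a ∈ U` carries a `-` spin next to `b`, then `a` is joined to a
seed. [cite: FriedliVelenik2017, Lemma 3.23 (proof)] -/
theorem reachesSeed_of_adj {σ : SpinConfig V} {a b : V} (ha : a ∈ U) (hσa : σ a = -1)
    (hadj : G.Adj a b) (hb : ReachesSeed G U D σ b) : ReachesSeed G U D σ a := by
  obtain ⟨z, hz, hbz⟩ := hb
  exact ⟨z, hz, Relation.ReflTransGen.head ⟨ha, hσa, hadj⟩ hbz⟩

omit [DecidableEq V] [G.LocallyFinite] in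
/-- A `-` site of `U` adjacent to a seed is joined to it.
[cite: FriedliVelenik2017, Lemma 3.23 (proof)] -/
theorem reachesSeed_of_adj_seed {σ : SpinConfig V} {a z : V} (ha : a ∈ U) (hσa : σ a = -1)
    (hz : z ∈ D) (hadj : G.Adj a z) : ReachesSeed G U D σ a :=
  ⟨z, hz, Relation.ReflTransGen.single ⟨ha, hσa, hadj⟩⟩

omit [DecidableEq V] [G.LocallyFinite] in
/-- The sites of the explored cluster carry `-` spins (the seeds lie off `U`).
[cite: FriedliVelenik2017, Lemma 3.23 (proof)] -/
theorem eq_neg_one_of_mem_exploredCluster (hDU : ∀ z ∈ D, z ∉ U) {σ : SpinConfig V} {x : V}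
    (hx : x ∈ exploredCluster G U D σ) : σ x = -1 := by
  obtain ⟨hxU, z, hz, hxz⟩ := (mem_exploredCluster G).1 hx
  rcases hxz.cases_head with rfl | ⟨c, hstep, -⟩
  · exact absurd hxU (hDU x hz)
  · exact hstep.2.1

omit [DecidableEq V] [G.LocallyFinite] in
/-- A chain of exploration steps starting off `U` is trivial.
[cite: FriedliVelenik2017, Lemma 3.23 (proof)] -/
theorem eq_of_reflTransGen_minusStep_of_notMem {σ : SpinConfig V} {b z : V} (hb : b ∉ U)
    (h : Relation.ReflTransGen (minusStep G U σ) b z) : b = z := by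
  rcases h.cases_head with rfl | ⟨c, hstep, -⟩
  · rfl
  · exact absurd hstep.1 hb

omit [G.LocallyFinite] in
/-- **Characterisation of the explored cluster, first half**: if `𝒞(σ) = C₀` then `σ ≡ -1` on
`C₀`, `σ ≡ +1` on the sealing layer `∂⁺C₀`, and `C₀` is seed-connected.
[cite: FriedliVelenik2017, Lemma 3.23 (proof)] -/
theorem of_exploredCluster_eq (hDU : ∀ z ∈ D, z ∉ U) {σ : SpinConfig V} {C₀ : Finset V}
    (hC : exploredCluster G U D σ = C₀) :
    (∀ x ∈ C₀, σ x = -1) ∧ (∀ x ∈ clusterBoundary G U D C₀, σ x = 1) ∧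
      IsSeedConnected G D C₀ := by
  refine ⟨fun x hx => eq_neg_one_of_mem_exploredCluster G hDU (hC.symm ▸ hx), fun x hx => ?_,
    fun x hx => ?_⟩
  · obtain ⟨hxU, hxC, y, hy, hadj⟩ := (mem_clusterBoundary G).1 hx
    rcases Int.units_eq_one_or (σ x) with h1 | h1
    · exact h1
    · exfalso
      apply hxC
      rw [← hC, mem_exploredCluster]
      refine ⟨hxU, ?_⟩
      rcases Finset.mem_union.1 hy with hyC | hyD
      · rw [← hC] at hyC
        exact reachesSeed_of_adj G hxU h1 hadj ((mem_exploredCluster G).1 hyC).2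
      · exact reachesSeed_of_adj_seed G hxU h1 hyD hadj
  · rw [← hC] at hx
    obtain ⟨hxU, z, hz, hxz⟩ := (mem_exploredCluster G).1 hx
    refine ⟨z, hz, ?_⟩
    -- every site along the chain is in the cluster
    clear hxU hx
    induction hxz using Relation.ReflTransGen.head_induction_on with
    | refl => exact Relation.ReflTransGen.refl
    | head hstep htail ih =>
      rename_i a c
      have haC : a ∈ C₀ := by
        rw [← hC, mem_exploredCluster]
        exact ⟨hstep.1, z, hz, Relation.ReflTransGen.head hstep htail⟩
      by_cases hcU : c ∈ U
      · exact Relation.ReflTransGen.head ⟨haC, hstep.2.2⟩ ih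
      · have hcz : c = z := eq_of_reflTransGen_minusStep_of_notMem G hcU htail
        subst hcz
        exact Relation.ReflTransGen.single ⟨haC, hstep.2.2⟩

omit [DecidableEq V] [G.LocallyFinite] in
/-- A chain inside a set `C₀ ⊆ U` of `-` spins is a chain of exploration steps.
[cite: FriedliVelenik2017, Lemma 3.23 (proof)] -/
theorem reflTransGen_minusStep_of_chain {σ : SpinConfig V} {C₀ : Finset V} (hC₀U : C₀ ⊆ U)
    (hminus : ∀ x ∈ C₀, σ x = -1) {x z : V}
    (hxz : Relation.ReflTransGen (fun a b => a ∈ C₀ ∧ G.Adj a b) x z) :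
    Relation.ReflTransGen (minusStep G U σ) x z := by
  induction hxz with
  | refl => exact Relation.ReflTransGen.refl
  | tail _ hbc ih => exact ih.tail ⟨hC₀U hbc.1, hminus _ hbc.1, hbc.2⟩

omit [G.LocallyFinite] in
/-- **Characterisation of the explored cluster, second half**: if `σ ≡ -1` on `C₀ ⊆ U`,
`σ ≡ +1` on `∂⁺C₀` and `C₀` is seed-connected, then `𝒞(σ) = C₀`.
[cite: FriedliVelenik2017, Lemma 3.23 (proof)] -/
theorem exploredCluster_eq_of (hDU : ∀ z ∈ D, z ∉ U) {σ : SpinConfig V} {C₀ : Finset V}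
    (hC₀U : C₀ ⊆ U) (hminus : ∀ x ∈ C₀, σ x = -1)
    (hplus : ∀ x ∈ clusterBoundary G U D C₀, σ x = 1) (hconn : IsSeedConnected G D C₀) :
    exploredCluster G U D σ = C₀ := by
  ext x
  rw [mem_exploredCluster]
  constructor
  · rintro ⟨hxU, z, hz, hxz⟩
    -- walk back from the seed: every site of `U` along the chain lies in `C₀`
    suffices key : ∀ a, Relation.ReflTransGen (minusStep G U σ) a z → a ∈ U → a ∈ C₀ from
      key x hxz hxU
    intro a haz
    induction haz using Relation.ReflTransGen.head_induction_on with
    | refl => intro hzU; exact absurd hzU (hDU z hz)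
    | head hstep htail ih =>
      rename_i a c
      intro haU
      by_contra haC
      have hσa : σ a = -1 := hstep.2.1
      have hbd : a ∈ clusterBoundary G U D C₀ := by
        by_cases hcU : c ∈ U
        · exact mem_clusterBoundary_of_adj_mem G haU haC (ih hcU) hstep.2.2
        · have hcz : c = z := eq_of_reflTransGen_minusStep_of_notMem G hcU htail
          subst hcz
          exact mem_clusterBoundary_of_adj_seed G haU haC hz hstep.2.2
      have := hplus a hbd
      rw [hσa] at this
      exact absurd this (by decide)
  · intro hx
    refine ⟨hC₀U hx, ?_⟩
    obtain ⟨z, hz, hxz⟩ := hconn x hx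
    exact ⟨z, hz, reflTransGen_minusStep_of_chain G hC₀U hminus hxz⟩

omit [G.LocallyFinite] in
/-- **The explored cluster is characterised by a cylinder event**: for `C₀ ⊆ U`,
`𝒞(σ) = C₀ ↔ σ ≡ -1 on C₀ ∧ σ ≡ +1 on ∂⁺C₀ ∧ C₀ seed-connected` — the event `{𝒞 = C₀}`
depends only on the spins of `C₀ ∪ ∂⁺C₀` (the sites "examined by the exploration").
[cite: FriedliVelenik2017, Lemma 3.23 (proof)] -/
theorem exploredCluster_eq_iff (hDU : ∀ z ∈ D, z ∉ U) {σ : SpinConfig V} {C₀ : Finset V}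
    (hC₀U : C₀ ⊆ U) :
    exploredCluster G U D σ = C₀ ↔ (∀ x ∈ C₀, σ x = -1) ∧
      (∀ x ∈ clusterBoundary G U D C₀, σ x = 1) ∧ IsSeedConnected G D C₀ :=
  ⟨of_exploredCluster_eq G hDU, fun h => exploredCluster_eq_of G hDU hC₀U h.1 h.2.1 h.2.2⟩

/-- The reference configuration of the cylinder `{𝒞 = C₀}`: `-1` on `C₀`, `+1` elsewhere.
[cite: FriedliVelenik2017, Lemma 3.23 (proof)] -/
def clusterConfig (C₀ : Finset V) : SpinConfig V :=
  fun x => if x ∈ C₀ then -1 else 1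

omit G [G.LocallyFinite] in
/-- `clusterConfig C₀ = -1` on `C₀`. [folklore] -/
theorem clusterConfig_apply_of_mem {C₀ : Finset V} {x : V} (hx : x ∈ C₀) :
    clusterConfig C₀ x = -1 := by
  simp [clusterConfig, hx]

omit G [G.LocallyFinite] in
/-- `clusterConfig C₀ = +1` off `C₀`. [folklore] -/
theorem clusterConfig_apply_of_notMem {C₀ : Finset V} {x : V} (hx : x ∉ C₀) :
    clusterConfig C₀ x = 1 := by
  simp [clusterConfig, hx]

omit [G.LocallyFinite] in
/-- The sealing layer is disjoint from `C₀`. [folklore] -/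
theorem notMem_of_mem_clusterBoundary {C₀ : Finset V} {x : V}
    (hx : x ∈ clusterBoundary G U D C₀) : x ∉ C₀ :=
  ((mem_clusterBoundary G).1 hx).2.1

omit [G.LocallyFinite] in
/-- **The cylinder indicator of `{𝒞 = C₀}`**: for seed-connected `C₀ ⊆ U`, the indicator of the
cylinder `{σ ≡ clusterConfig C₀ on C₀ ∪ ∂⁺C₀}` is `1` exactly when `𝒞(σ) = C₀`.
[cite: FriedliVelenik2017, Lemma 3.23 (proof)] -/
theorem cylInd_cluster_eq (hDU : ∀ z ∈ D, z ∉ U) {C₀ : Finset V} (hC₀U : C₀ ⊆ U)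
    (hconn : IsSeedConnected G D C₀) (σ : SpinConfig V) :
    cylInd (C₀ ∪ clusterBoundary G U D C₀) (clusterConfig C₀) σ =
      if exploredCluster G U D σ = C₀ then 1 else 0 := by
  unfold cylInd
  have hiff : (∀ x ∈ C₀ ∪ clusterBoundary G U D C₀, σ x = clusterConfig C₀ x) ↔
      exploredCluster G U D σ = C₀ := by
    rw [exploredCluster_eq_iff G hDU hC₀U]
    constructor
    · intro h
      refine ⟨fun x hx => ?_, fun x hx => ?_, hconn⟩
      · rw [h x (Finset.mem_union_left _ hx), clusterConfig_apply_of_mem hx]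
      · rw [h x (Finset.mem_union_right _ hx),
          clusterConfig_apply_of_notMem (notMem_of_mem_clusterBoundary G hx)]
    · rintro ⟨hm, hp, -⟩ x hx
      rcases Finset.mem_union.1 hx with hxC | hxB
      · rw [hm x hxC, clusterConfig_apply_of_mem hxC]
      · rw [hp x hxB, clusterConfig_apply_of_notMem (notMem_of_mem_clusterBoundary G hxB)]
  by_cases h : exploredCluster G U D σ = C₀
  · rw [if_pos h, if_pos (hiff.2 h)]
  · rw [if_neg h, if_neg (fun h' => h (hiff.1 h'))]

end Cluster

/-! ### Screening: the good event decouples the two boundary conditions -/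

section Screening

variable {W U L D : Finset V}

/-- **The good event** of the screening argument: the explored cluster misses the cut `L`.
[cite: VanenterFernandezSokal1993, §4.3.1 Step 2] -/
def IsGood (U L D : Finset V) (σ : SpinConfig V) : Prop :=
  ∀ x ∈ L, x ∉ exploredCluster G U D σ

/-- The indicator of the good event. [cite: VanenterFernandezSokal1993, §4.3.1 Step 2] -/
def goodInd (U L D : Finset V) (σ : SpinConfig V) : ℝ :=
  open Classical in if IsGood G U L D σ then 1 else 0

/-- The admissible values of the explored cluster on the good event: seed-connected subsets of
`U` missing `L`. [cite: FriedliVelenik2017, Lemma 3.23 (proof)] -/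
def goodFamily (U L D : Finset V) : Finset (Finset V) :=
  open Classical in U.powerset.filter fun C₀ => (∀ x ∈ L, x ∉ C₀) ∧ IsSeedConnected G D C₀

omit [G.LocallyFinite] in
/-- Membership in `goodFamily`. [folklore] -/
theorem mem_goodFamily {C₀ : Finset V} :
    C₀ ∈ goodFamily G U L D ↔ C₀ ⊆ U ∧ (∀ x ∈ L, x ∉ C₀) ∧ IsSeedConnected G D C₀ := by
  classical
  simp [goodFamily]

omit [G.LocallyFinite] in
/-- **Partition of the good event by the value of the explored cluster**: pointwise,
`𝟙_GOOD = ∑_{C₀ ∈ goodFamily} 𝟙{σ ≡ clusterConfig C₀ on C₀ ∪ ∂⁺C₀}`.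
[cite: FriedliVelenik2017, Lemma 3.23 (proof)] -/
theorem goodInd_eq_sum_cylInd (hDU : ∀ z ∈ D, z ∉ U) (σ : SpinConfig V) :
    goodInd G U L D σ =
      ∑ C₀ ∈ goodFamily G U L D,
        cylInd (C₀ ∪ clusterBoundary G U D C₀) (clusterConfig C₀) σ := by
  classical
  have hterm : ∀ C₀ ∈ goodFamily G U L D,
      cylInd (C₀ ∪ clusterBoundary G U D C₀) (clusterConfig C₀) σ =
        if exploredCluster G U D σ = C₀ then 1 else 0 := by
    intro C₀ hC₀
    obtain ⟨hC₀U, -, hconn⟩ := (mem_goodFamily G).1 hC₀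
    exact cylInd_cluster_eq G hDU hC₀U hconn σ
  rw [Finset.sum_congr rfl hterm, Finset.sum_ite_eq]
  have hmem : exploredCluster G U D σ ∈ goodFamily G U L D ↔ IsGood G U L D σ := by
    rw [mem_goodFamily]
    constructor
    · rintro ⟨-, hL, -⟩; exact hL
    · intro hg
      exact ⟨exploredCluster_subset G σ, hg, (of_exploredCluster_eq G hDU rfl).2.2⟩
  unfold goodInd
  by_cases hg : IsGood G U L D σ
  · rw [if_pos hg, if_pos (hmem.2 hg)]
  · rw [if_neg hg, if_neg (fun h' => hg (hmem.1 h'))]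

omit [G.LocallyFinite] in
/-- `goodInd` is measurable, being a finite sum of cylinder indicators. [folklore] -/
theorem measurable_goodInd (hUW : U ⊆ W) (hDW : ∀ z ∈ D, z ∉ W) :
    Measurable (goodInd G U L D) := by
  have hDU : ∀ z ∈ D, z ∉ U := fun z hz hzU => hDW z hz (hUW hzU)
  have : goodInd G U L D =
      fun σ => ∑ C₀ ∈ goodFamily G U L D,
        cylInd (C₀ ∪ clusterBoundary G U D C₀) (clusterConfig C₀) σ :=
    funext fun σ => goodInd_eq_sum_cylInd G hDU σ
  rw [this]
  exact Finset.measurable_sum _ fun C₀ _ => measurable_cylInd _ _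

/-- **Screening of the boundary condition by the good event** (the finite-volume content of
van Enter–Fernández–Sokal 1993, §4.3.1 Steps 2.1–2.2, by the exploration argument of
Friedli–Velenik 2017, Lemma 3.23): let `U ⊆ W`, seeds `D` off `W` whose `W`-neighbours all lie
in `U`, a cut `L` such that the sites of `W ∖ U` see `U` only through `L`; let `η⁻`, `η⁺` be two
boundary conditions agreeing off `D`, `β ≥ 0`, and `f ≥ 0` nondecreasing, measurable, depending
only on the spins of `W ∖ U`. Then
`μ^{η⁻}_{W;β,h}(GOOD) · ⟨f⟩^{η⁺}_{W;β,h} ≤ ⟨f⟩^{η⁻}_{W;β,h}`: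
on `{𝒞 = C₀}` (`C₀` missing `L`) the conditional law of the spins off `C₀ ∪ ∂⁺C₀` is the
finite-volume measure in `W ∖ (C₀ ∪ ∂⁺C₀)` with boundary spins `+1` on the sealing layer, which
no longer sees `D` and dominates `⟨·⟩^{η⁺}_W` on nondecreasing `f` by FKG.
[cite: VanenterFernandezSokal1993, §4.3.1 Steps 2.1–2.2] [cite: FriedliVelenik2017, Lemma 3.23] -/
theorem isingExpect_mul_le_of_screening (hUW : U ⊆ W) (hDW : ∀ z ∈ D, z ∉ W)
    (hDnb : ∀ z ∈ D, ∀ x ∈ W, G.Adj x z → x ∈ U)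
    (hcut : ∀ x ∈ W, x ∉ U → ∀ u ∈ U, G.Adj x u → u ∈ L)
    {β : ℝ} (hβ : 0 ≤ β) (h : ℝ) {ηm ηp : SpinConfig V} (hη : ∀ y, y ∉ D → ηm y = ηp y)
    {f : SpinConfig V → ℝ} (hf : Monotone f) (hfm : Measurable f) (hf0 : ∀ σ, 0 ≤ f σ)
    (hfloc : ∀ σ σ' : SpinConfig V, (∀ x ∈ W, x ∉ U → σ x = σ' x) → f σ = f σ') :
    isingExpect G W β h (.fixed ηm) (goodInd G U L D) * isingExpect G W β h (.fixed ηp) f ≤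
      isingExpect G W β h (.fixed ηm) f := by
  classical
  have hDU : ∀ z ∈ D, z ∉ U := fun z hz hzU => hDW z hz (hUW hzU)
  set 𝒢 := goodFamily G U L D with h𝒢
  set K : Finset V → Finset V := fun C₀ => C₀ ∪ clusterBoundary G U D C₀ with hK
  have hKU : ∀ C₀ ∈ 𝒢, K C₀ ⊆ U := fun C₀ hC₀ => by
    obtain ⟨hC₀U, -, -⟩ := (mem_goodFamily G).1 hC₀
    exact Finset.union_subset hC₀U (fun x hx => ((mem_clusterBoundary G).1 hx).1)
  have hKW : ∀ C₀ ∈ 𝒢, K C₀ ⊆ W := fun C₀ hC₀ => (hKU C₀ hC₀).trans hUW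
  -- Step 1: `⟨goodInd⟩ = ∑ ⟨cyl⟩` and `⟨f · goodInd⟩ = ∑ ⟨f · cyl⟩`
  have hgood_fun : goodInd G U L D = fun σ => ∑ C₀ ∈ 𝒢, cylInd (K C₀) (clusterConfig C₀) σ :=
    funext fun σ => goodInd_eq_sum_cylInd G hDU σ
  have hcylm : ∀ C₀ ∈ 𝒢, Measurable (cylInd (K C₀) (clusterConfig C₀)) :=
    fun C₀ _ => measurable_cylInd _ _
  have hE_good : isingExpect G W β h (.fixed ηm) (goodInd G U L D) =
      ∑ C₀ ∈ 𝒢, isingExpect G W β h (.fixed ηm) (cylInd (K C₀) (clusterConfig C₀)) := by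
    rw [hgood_fun]
    exact isingExpect_finset_sum' G W h _ β 𝒢 (fun C₀ => cylInd (K C₀) (clusterConfig C₀))
      fun C₀ => measurable_cylInd _ _
  have hE_fgood : isingExpect G W β h (.fixed ηm) (fun σ => f σ * goodInd G U L D σ) =
      ∑ C₀ ∈ 𝒢, isingExpect G W β h (.fixed ηm)
        (fun σ => f σ * cylInd (K C₀) (clusterConfig C₀) σ) := by
    have : (fun σ => f σ * goodInd G U L D σ) =
        fun σ => ∑ C₀ ∈ 𝒢, f σ * cylInd (K C₀) (clusterConfig C₀) σ := by
      funext σ; rw [hgood_fun, Finset.mul_sum]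
    rw [this]
    exact isingExpect_finset_sum' G W h _ β 𝒢 (fun C₀ σ => f σ * cylInd (K C₀) (clusterConfig C₀) σ)
      fun C₀ => hfm.mul (measurable_cylInd _ _)
  -- Step 2: on each cylinder, Markov property + locality + FKG
  have hterm : ∀ C₀ ∈ 𝒢,
      isingExpect G W β h (.fixed ηm) (cylInd (K C₀) (clusterConfig C₀)) *
          isingExpect G W β h (.fixed ηp) f ≤
        isingExpect G W β h (.fixed ηm) (fun σ => f σ * cylInd (K C₀) (clusterConfig C₀) σ) := by
    intro C₀ hC₀
    obtain ⟨hC₀U, hC₀L, -⟩ := (mem_goodFamily G).1 hC₀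
    rw [isingExpect_mul_cylInd G (hKW C₀ hC₀) β h ηm (clusterConfig C₀) hfm]
    refine mul_le_mul_of_nonneg_left ?_ (isingExpect_cylInd_pos G (hKW C₀ hC₀) β h ηm _).le
    -- the two boundary conditions agree on the outer boundary of `W ∖ K C₀`
    have hbc : ∀ y ∈ outerBoundary G (W \ K C₀),
        reglue (K C₀) ηp (1 : SpinConfig V) y = reglue (K C₀) ηm (clusterConfig C₀) y := by
      intro y hy
      obtain ⟨hyWK, x, hx, hadj⟩ := mem_outerBoundary_iff.1 hy
      obtain ⟨hxW, hxK⟩ := Finset.mem_sdiff.1 hx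
      have hxC : x ∉ C₀ := fun h' => hxK (Finset.mem_union_left _ h')
      by_cases hyW : y ∈ W
      · -- then `y ∈ K C₀`, and in fact in the sealing layer
        have hyK : y ∈ K C₀ := by
          by_contra h'
          exact hyWK (Finset.mem_sdiff.2 ⟨hyW, h'⟩)
        have hyC : y ∉ C₀ := by
          intro hyC
          by_cases hxU : x ∈ U
          · exact hxK (Finset.mem_union_right _
              (mem_clusterBoundary_of_adj_mem G hxU hxC hyC hadj.symm))
          · exact hC₀L y (hcut x hxW hxU y (hC₀U hyC) hadj.symm) hyC
        rw [reglue_apply_of_mem _ _ _ hyK, reglue_apply_of_mem _ _ _ hyK,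
          clusterConfig_apply_of_notMem hyC]
        rfl
      · have hyK : y ∉ K C₀ := fun h' => hyW (hKW C₀ hC₀ h')
        rw [reglue_apply_of_notMem _ _ _ hyK, reglue_apply_of_notMem _ _ _ hyK]
        have hyD : y ∉ D := by
          intro hyD
          have hxU : x ∈ U := hDnb y hyD x hxW hadj.symm
          exact hxK (Finset.mem_union_right _
            (mem_clusterBoundary_of_adj_seed G hxU hxC hyD hadj.symm))
        exact (hη y hyD).symm
    have hfloc' : ∀ σ σ' : SpinConfig V, (∀ x ∈ W \ K C₀, σ x = σ' x) → f σ = f σ' :=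
      fun σ σ' hσ => hfloc σ σ' fun x hxW hxU =>
        hσ x (Finset.mem_sdiff.2 ⟨hxW, fun h' => hxU (hKU C₀ hC₀ h')⟩)
    rw [← isingExpect_fixed_congr_outerBoundary G hbc β h hfm hfloc']
    exact isingExpect_le_isingExpect_sdiff_reglue_one G (hKW C₀ hC₀) hβ h ηp hf hfm
  -- Step 3: sum, and `f · goodInd ≤ f`
  have hgm : Measurable (goodInd G U L D) := by
    rw [hgood_fun]; exact Finset.measurable_sum _ hcylm
  calc isingExpect G W β h (.fixed ηm) (goodInd G U L D) * isingExpect G W β h (.fixed ηp) f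
      = ∑ C₀ ∈ 𝒢, isingExpect G W β h (.fixed ηm) (cylInd (K C₀) (clusterConfig C₀)) *
          isingExpect G W β h (.fixed ηp) f := by rw [hE_good, Finset.sum_mul]
    _ ≤ ∑ C₀ ∈ 𝒢, isingExpect G W β h (.fixed ηm)
          (fun σ => f σ * cylInd (K C₀) (clusterConfig C₀) σ) := Finset.sum_le_sum hterm
    _ = isingExpect G W β h (.fixed ηm) (fun σ => f σ * goodInd G U L D σ) := hE_fgood.symm
    _ ≤ isingExpect G W β h (.fixed ηm) f := by
        refine isingExpect_mono_fun G W β h _ (hfm.mul hgm) hfm fun σ => ?_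
        have h1 : goodInd G U L D σ ≤ 1 := by
          unfold goodInd; split_ifs <;> norm_num
        have h0 : 0 ≤ goodInd G U L D σ := by
          unfold goodInd; split_ifs <;> norm_num
        nlinarith [hf0 σ]

end Screening

/-! ### The bad event is covered by the cylinders of connected clusters -/

section Bad

variable {W U L D : Finset V}

/-- The `U`-neighbours of `T` outside `T`. [cite: FriedliVelenik2017, Lemma 3.36] -/
def uBoundary (U T : Finset V) : Finset V :=
  open Classical in (U \ T).filter fun z => ∃ t ∈ T, G.Adj z t

omit [G.LocallyFinite] in
/-- Membership in `uBoundary`. [folklore] -/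
theorem mem_uBoundary {T : Finset V} {z : V} :
    z ∈ uBoundary G U T ↔ z ∈ U ∧ z ∉ T ∧ ∃ t ∈ T, G.Adj z t := by
  classical
  simp only [uBoundary, Finset.mem_filter, Finset.mem_sdiff, and_assoc]

/-- **The family of possible bad clusters**: connected subsets `T ⊆ U` meeting the cut `L` and
adjacent to a seed. [cite: FriedliVelenik2017, Lemma 3.36] -/
def badFamily (U L D : Finset V) : Finset (Finset V) :=
  open Classical in U.powerset.filter fun T =>
    IsGraphConnected G T ∧ (∃ x ∈ L, x ∈ T) ∧ ∃ t ∈ T, ∃ z ∈ D, G.Adj t z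

omit [G.LocallyFinite] in
/-- Membership in `badFamily`. [folklore] -/
theorem mem_badFamily {T : Finset V} :
    T ∈ badFamily G U L D ↔
      T ⊆ U ∧ IsGraphConnected G T ∧ (∃ x ∈ L, x ∈ T) ∧ ∃ t ∈ T, ∃ z ∈ D, G.Adj t z := by
  classical
  simp [badFamily]

omit [G.LocallyFinite] in
/-- **On the bad event some member of `badFamily` is a `-` cluster sealed by `+` spins in `U`.**
If `x ∈ L` lies in the explored cluster `𝒞(σ)`, the connected component `T` of `x` in `𝒞(σ)` is
a connected subset of `U` through `x`, adjacent to a seed, with `σ ≡ -1` on `T` and `σ ≡ +1` on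
its `U`-neighbours. [cite: FriedliVelenik2017, Lemma 3.36 (proof)] -/
theorem exists_mem_badFamily_of_mem_exploredCluster (hDU : ∀ z ∈ D, z ∉ U) {σ : SpinConfig V}
    {x : V} (hxL : x ∈ L) (hx : x ∈ exploredCluster G U D σ) :
    ∃ T ∈ badFamily G U L D, (∀ t ∈ T, σ t = -1) ∧ ∀ z ∈ uBoundary G U T, σ z = 1 := by
  classical
  set C := exploredCluster G U D σ with hCdef
  -- the component of `x` inside the cluster
  set r : V → V → Prop := fun a b => G.Adj a b ∧ a ∈ C ∧ b ∈ C with hrdef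
  set T : Finset V := C.filter fun y => Relation.ReflTransGen r x y with hTdef
  have hmemT : ∀ {y}, y ∈ T ↔ y ∈ C ∧ Relation.ReflTransGen r x y := fun {y} => by
    rw [hTdef, Finset.mem_filter]
  have hxT : x ∈ T := hmemT.2 ⟨hx, Relation.ReflTransGen.refl⟩
  have hTC : T ⊆ C := fun y hy => (hmemT.1 hy).1
  have hTU : T ⊆ U := hTC.trans (exploredCluster_subset G σ)
  -- chains inside `C` from `x` are chains inside `T`
  have hlift : ∀ {w}, Relation.ReflTransGen r x w →
      Relation.ReflTransGen (fun a b => G.Adj a b ∧ a ∈ T ∧ b ∈ T) x w := by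
    intro w hw
    induction hw with
    | refl => exact Relation.ReflTransGen.refl
    | tail hxb hbw ih =>
      exact Relation.ReflTransGen.tail ih ⟨hbw.1, hmemT.2 ⟨hbw.2.1, hxb⟩,
        hmemT.2 ⟨hbw.2.2, hxb.tail hbw⟩⟩
  have hconn : IsGraphConnected G T :=
    (isGraphConnected_iff_reflTransGen (G := G) hxT).2 fun w hw => hlift (hmemT.1 hw).2
  -- `T` is adjacent to a seed: follow the exploration chain of `x`
  have hadjD : ∃ t ∈ T, ∃ z ∈ D, G.Adj t z := by
    obtain ⟨-, z, hz, hxz⟩ := (mem_exploredCluster G).1 hx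
    suffices key : ∀ a, Relation.ReflTransGen (minusStep G U σ) a z → a ∈ T →
        ∃ t ∈ T, ∃ z ∈ D, G.Adj t z from key x hxz hxT
    intro a haz
    induction haz using Relation.ReflTransGen.head_induction_on with
    | refl => intro hzT; exact absurd (hTU hzT) (hDU z hz)
    | head hstep htail ih =>
      rename_i a c
      intro haT
      by_cases hcU : c ∈ U
      · have hcC : c ∈ C := (mem_exploredCluster G).2 ⟨hcU, z, hz, htail⟩
        have hcT : c ∈ T := hmemT.2 ⟨hcC, (hmemT.1 haT).2.tail ⟨hstep.2.2, hTC haT, hcC⟩⟩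
        exact ih hcT
      · have hcz : c = z := eq_of_reflTransGen_minusStep_of_notMem G hcU htail
        subst hcz
        exact ⟨a, haT, c, hz, hstep.2.2⟩
  refine ⟨T, (mem_badFamily G).2 ⟨hTU, hconn, ⟨x, hxL, hxT⟩, hadjD⟩,
    fun t ht => eq_neg_one_of_mem_exploredCluster G hDU (hTC ht), fun w hw => ?_⟩
  obtain ⟨hwU, hwT, t, ht, hadj⟩ := (mem_uBoundary G).1 hw
  rcases Int.units_eq_one_or (σ w) with h1 | h1
  · exact h1
  · exfalso
    apply hwT
    have htC : t ∈ C := hTC ht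
    have hwC : w ∈ C := (mem_exploredCluster G).2
      ⟨hwU, reachesSeed_of_adj G hwU h1 hadj ((mem_exploredCluster G).1 htC).2⟩
    exact hmemT.2 ⟨hwC, (hmemT.1 ht).2.tail ⟨hadj.symm, htC, hwC⟩⟩

/-- **Union bound for the bad event**: the probability that the explored cluster reaches the
cut `L` is at most the sum, over the connected `T ⊆ U` meeting `L` and adjacent to a seed, of the
probabilities of "`σ ≡ -1` on `T`, `σ ≡ +1` on the `U`-neighbours of `T`" — each of which
Peierls' flip estimate bounds by `exp(-2β(g - b))` (`IsingPeierlsFlip`).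
[cite: FriedliVelenik2017, Lemma 3.36 and eq. (3.38)] -/
theorem isingMeasure_bad_le_sum (hUW : U ⊆ W) (hDW : ∀ z ∈ D, z ∉ W) (β h : ℝ)
    (η : SpinConfig V) :
    (isingMeasure G W β h (.fixed η)).real {σ | ¬ IsGood G U L D σ} ≤
      ∑ T ∈ badFamily G U L D, (isingMeasure G W β h (.fixed η)).real
        {σ | (∀ t ∈ T, σ t = -1) ∧ ∀ z ∈ uBoundary G U T, σ z = 1} := by
  have hDU : ∀ z ∈ D, z ∉ U := fun z hz hzU => hDW z hz (hUW hzU)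
  refine le_trans (measureReal_mono ?_ (measure_ne_top _ _)) (measureReal_biUnion_finset_le _ _)
  intro σ hσ
  simp only [Set.mem_setOf_eq, IsGood, not_forall, not_not, exists_prop] at hσ
  obtain ⟨x, hxL, hx⟩ := hσ
  obtain ⟨T, hT, hmin, hpl⟩ := exists_mem_badFamily_of_mem_exploredCluster G hDU hxL hx
  exact Set.mem_biUnion hT ⟨hmin, hpl⟩

/-- **Screening, probability form**: under the hypotheses of `isingExpect_mul_le_of_screening`
and `0 ≤ f ≤ 1`,
`⟨f⟩^{η⁺}_W - ⟨f⟩^{η⁻}_W ≤ μ^{η⁻}_W(BAD) ≤ ∑_{T ∈ badFamily} μ^{η⁻}_W(σ ≡ -1 on T, +1 on ∂_U T)`.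
[cite: VanenterFernandezSokal1993, §4.3.1 Steps 2.1–2.2] [cite: FriedliVelenik2017, Lemma 3.23] -/
theorem isingExpect_sub_le_sum_of_screening (hUW : U ⊆ W) (hDW : ∀ z ∈ D, z ∉ W)
    (hDnb : ∀ z ∈ D, ∀ x ∈ W, G.Adj x z → x ∈ U)
    (hcut : ∀ x ∈ W, x ∉ U → ∀ u ∈ U, G.Adj x u → u ∈ L)
    {β : ℝ} (hβ : 0 ≤ β) (h : ℝ) {ηm ηp : SpinConfig V} (hη : ∀ y, y ∉ D → ηm y = ηp y)
    {f : SpinConfig V → ℝ} (hf : Monotone f) (hfm : Measurable f) (hf0 : ∀ σ, 0 ≤ f σ)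
    (hf1 : ∀ σ, f σ ≤ 1)
    (hfloc : ∀ σ σ' : SpinConfig V, (∀ x ∈ W, x ∉ U → σ x = σ' x) → f σ = f σ') :
    isingExpect G W β h (.fixed ηp) f - isingExpect G W β h (.fixed ηm) f ≤
      ∑ T ∈ badFamily G U L D, (isingMeasure G W β h (.fixed ηm)).real
        {σ | (∀ t ∈ T, σ t = -1) ∧ ∀ z ∈ uBoundary G U T, σ z = 1} := by
  classical
  have hscr := isingExpect_mul_le_of_screening G hUW hDW hDnb hcut hβ h hη hf hfm hf0 hfloc
  have hbad := isingMeasure_bad_le_sum G (L := L) hUW hDW β h ηm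
  -- `⟨goodInd⟩ = 1 - μ(BAD)`
  have hgm : Measurable (goodInd G U L D) := measurable_goodInd G hUW hDW
  have hBADm : MeasurableSet {σ : SpinConfig V | ¬ IsGood G U L D σ} := by
    have : {σ : SpinConfig V | ¬ IsGood G U L D σ} = goodInd G U L D ⁻¹' {0} := by
      ext σ
      simp only [Set.mem_setOf_eq, Set.mem_preimage, Set.mem_singleton_iff, goodInd]
      split_ifs with hg <;> simp [hg]
    rw [this]
    exact hgm (measurableSet_singleton _)
  have hgood_eq : isingExpect G W β h (.fixed ηm) (goodInd G U L D) =
      1 - (isingMeasure G W β h (.fixed ηm)).real {σ | ¬ IsGood G U L D σ} := by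
    have hind : goodInd G U L D =
        fun σ => 1 - Set.indicator {σ : SpinConfig V | ¬ IsGood G U L D σ} 1 σ := by
      funext σ
      by_cases hg : IsGood G U L D σ
      · rw [Set.indicator_of_notMem (show σ ∉ {σ : SpinConfig V | ¬ IsGood G U L D σ} from
          fun h' => h' hg)]
        simp [goodInd, hg]
      · rw [Set.indicator_of_mem (show σ ∈ {σ : SpinConfig V | ¬ IsGood G U L D σ} from hg)]
        simp [goodInd, hg]
    have hint1 : Integrable (fun _ : SpinConfig V => (1 : ℝ)) (isingMeasure G W β h (.fixed ηm)) :=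
      integrable_const _
    have hint2 : Integrable (Set.indicator {σ : SpinConfig V | ¬ IsGood G U L D σ}
        (1 : SpinConfig V → ℝ)) (isingMeasure G W β h (.fixed ηm)) := hint1.indicator hBADm
    rw [hind, isingExpect, integral_sub hint1 hint2, integral_const, probReal_univ, one_smul,
      integral_indicator_one hBADm]
  have hEp_le : isingExpect G W β h (.fixed ηp) f ≤ 1 := by
    calc isingExpect G W β h (.fixed ηp) f ≤ isingExpect G W β h (.fixed ηp) (fun _ => (1 : ℝ)) :=
          isingExpect_mono_fun G W β h _ hfm measurable_const hf1
      _ = 1 := by rw [isingExpect, integral_const, probReal_univ, one_smul]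
  have hEp_nn : 0 ≤ isingExpect G W β h (.fixed ηp) f := by
    calc (0 : ℝ) = isingExpect G W β h (.fixed ηp) (fun _ => (0 : ℝ)) := by
          rw [isingExpect, integral_const, smul_zero]
      _ ≤ isingExpect G W β h (.fixed ηp) f :=
          isingExpect_mono_fun G W β h _ measurable_const hfm hf0
  have hreal_nn : 0 ≤ (isingMeasure G W β h (.fixed ηm)).real {σ | ¬ IsGood G U L D σ} :=
    measureReal_nonneg
  rw [hgood_eq] at hscr
  nlinarith [hscr, hbad, hEp_le, hEp_nn, hreal_nn]

end Bad

end Literature.Probability.LatticeModels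

end
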